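import Literature.MathematicalPhysics.QuantumFieldTheory.Balaban1983to89.B9Thm37GlueTorusCovTower

/-!
# `Balaban1983to89.B9Thm37GlueTorusCovTowerDir` — THE DIRICHLET PACKAGE OF THE TOWER OPERATOR: for the
# (k+1)-level operator Δ_U + Σ_{l≤k} a_l·G_lᵀG_l of the comb tower and a region Ω₀ covered by the levels, the
# Dirichlet inverse G′ = (Ω₀Δ′Ω₀)⁻¹ EXISTS as a two-sided inverse on Ω₀, lives on Ω₀, is symmetric, has a
# nonnegative form, and obeys ‖G′g‖ ≤ σ_k⁻¹‖g‖ with ONE σ_k for every transport and every volume — the ℓ² part of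
# the shape of [B9] Theorem 3.7's G′ for the printed operator, assembled in one statement
# (MODEL; own lineage pv21; imports `B9Thm37GlueTorusCovTower` only; modifies nothing)

References (bib keys; the tags below cite only these):
* [B9] = `Balaban1985BackgroundPropagators` — T. Bałaban, *Propagators for lattice gauge theories in a background
  field*, Commun. Math. Phys. 99 (1985) 389–434.
* [B7] = `Balaban1985Averaging` — T. Bałaban, *Averaging operations for lattice gauge theories*, Commun. Math. Phys.
  98 (1985) 17–51 (= reference [5] of [B9]; only NAMED, through `B9Thm37GlueTorusCovComp`).

THE PRINTED LOCI.  NO new «» span in this file; everything printed is only NAMED and is certified in the headers of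
modules in the import closure: [B9] (3.16) p. 393 (the level sum, `B9Thm37GlueTorusCovLevels`), (3.15)/(3.18)–(3.19)
p. 393 (`B9Thm37GlueTorusCov`, `B9Thm37GlueTorusCovComp`), (3.3) pp. 390–391 (∇_U, `B9Thm37Glue`), p. 391 (L²
adjoints, `B9Thm37GlueTorusInv`), (3.23)–(3.24) p. 394 (Δ′_a = Δ_U + Q′\*aQ′), p. 394 (Ω₀Δ′_aΩ₀ and its inverse
G′, `B9Thm37GlueTorusInv`), p. 395 (positivity of Δ′_a and of G′, `B9Thm37Glue`), Theorem 3.7 p. 409 (only its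
SHAPE is referred to; its decay content is NOT touched — see the honest scope).  NOTHING printed is asserted as a
theorem — every declaration below is a kernel-checked theorem about the component MODEL of the lineage
(`B9Thm37Glue.covD`/`mulOp`/`IsTransposePair`, `B9Thm37GlueTorusInv.dirInv`, `B9Thm37GlueTorusCov.Comb`,
`B9Thm37GlueTorusCovLevels.levelOp`, `B9Thm37GlueTorusCovLevelsPoinc.sigmaL`,
`B9Thm37GlueTorusCovTower.towerOp`/`towerBlk`/`towerTr`/`sigmaTower`/`sigmaTowerTorus`).

THE POINT (value = a MODEL kernel certificate steering the lineage; NOT summit progress).  The chain's capstones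
(`B9Thm37GlueTorusInv` §5–§6, `…TorusRW`, `…TorusScaled`) are wired to the DIAGONAL mass Δ_U + M_q; the level
files (`…CovLevels`, `…CovLevelsPoinc`, `…CovLevelsTower`, `…CovTower`) built the printed operator shape and its
coercivity but recorded "the capstones of the chain are not re-wired" (honest scope (iii) of each).  THIS FILE
re-wires the ℓ² PART for the tower operator:
 * §1 GENERIC (finite X).  `dirInv_qform_nonneg`: if A + (1 − Ω₀) is strictly positive then the Dirichlet inverse
   G′ = `dirInv A Ω₀` has a nonnegative form, Σ_x g(x)(G′g)(x) ≥ 0 for every g (no symmetry of A needed: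
   ⟨Ω₀g, S⁻¹Ω₀g⟩ = ⟨u, Su⟩ ≥ 0 with S = Ω₀AΩ₀ + (1 − Ω₀), u = S⁻¹Ω₀g).
 * §2 THE TOWER (any sequence of combs K_j, any k; isometric bond matrices, |c(b)| ≥ c_min > 0, K_j of depth ≤ D_j
   with blocks of ≤ n_j sites, all a_l ≥ 0, block weights W_l = w_l ∘ towerBlk_l).  `towerTr_reproduces` (all tower
   transports reproduce covariantly constant fields from the representative site: ∇_U f = 0 ⇒ G_l f = f ∘ towerBlk_l
   componentwise, all c(b) ≠ 0).  Under the cover of Ω₀ = {χ = 1} (χ {0,1}-valued) — every site of Ω₀ has SOME level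
   l ≤ k with a_l ≥ a_min > 0 and |w_l| ≥ w_min > 0 at its level-l block: **`posDef_towerDirOp`** (Δ′ + (1 − Ω₀) is
   strictly positive, from `coercive_towerOp` via `posDef_add_compl_of_coercive`), **`towerDir_right`** /
   **`towerDir_left`** (G′ := `dirInv Δ′ χ` satisfies Ω₀Δ′Ω₀·G′ = Ω₀ and G′·Ω₀Δ′Ω₀ = Ω₀), `towerDir_supported`
   (Ω₀G′Ω₀ = G′), `isTransposePair_towerDir` (G′ symmetric), `towerDir_qform_nonneg` (⟨g, G′g⟩ ≥ 0); under the FULL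
   cover: `isUnit_towerOp`, `inverse_mul_towerOp`, `mul_inverse_towerOp`.  **`thm37_l2_tower`**: the six ℓ²
   properties of G′ in ONE conjunction, the bound being Σ_p (G′g)(p)² ≤ σ_k⁻²·Σ_p g(p)² with σ_k =
   `sigmaTower a_min w_min c_min D n k` (`B9Thm37GlueTorusCovTower.towerDir_sq_le`) — the same for every transport.
 * §3 THE TORUS `UT N`, cube combs of sides M_j: **`thm37_l2_tower_torus`** — the same conjunction with σ_k =
   `sigmaTowerTorus d M a_min w_min c_min k`, independent of the volume N and of the transport U.

NOT ASSERTED, NOT MODELLED (honest scope).  (i) ℓ² ONLY: NO decay of G′ — the random-walk / (1.31)-type bounds of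
`B9Thm37GlueTorusRW` / `…TorusScaled` are for the diagonal mass and are NOT transferred to the level operator
(the level sum is non-local; no sitewise maximum principle is claimed); nothing of (3.17), Theorems 3.1–3.3,
Corollary 3.6, (1.31)/Proposition 1.1, and NOTHING of the CONTENT of Theorem 3.7 beyond the existence /
symmetry / positivity / boundedness shape of G′ on a covered region.  (ii) As in the import closure: Ū of [B7]
(42)–(43) NOT constructed (tower transports = ordered products of comb holonomies of U itself); crude constants
(P_j ~ 2^j, ONE global σ_k, not print's scale-dependent local bounds); component site fields.  (iii) The region Ω₀
is an arbitrary {χ = 1}; print's Ω₀(□) (p. 408) and the partition of unity of the glue are not touched here.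
Value = MODEL kernel certificate, NOT summit progress; NOT continuum, NOT Clay, NOT a claim about print.
-/

namespace Literature.MathematicalPhysics.QuantumFieldTheory.Balaban1983to89.B9Thm37GlueTorusCovTowerDir

open Finset B9Thm37Sum B9Thm37Glue B9Thm37GlueTorusInv B9Thm37GlueTorusCov B9Thm37GlueTorusCovComp
  B9Thm37GlueTorusCovPoinc B9Thm37GlueTorusCovLevels B9Thm37GlueTorusCovLevelsPoinc B9Thm37GlueTorusCovLevelsTower
  B9Thm37GlueTorusCovTower
open B5TorusCover (UT Ctr ctrU)

noncomputable section

/-! ## §1  Generic: the Dirichlet inverse of a strictly positive Dirichlet problem has a nonnegative form -/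

section Generic

variable {X : Type} [Fintype X]

/-- **⟨g, G′g⟩ ≥ 0** for G′ = `dirInv A Ω₀` whenever A + (1 − Ω₀) is strictly positive (Ω₀ = {χ = 1}, χ
{0,1}-valued): with S = Ω₀AΩ₀ + (1 − Ω₀) (strictly positive, `posDef_sandwich`) and u = S⁻¹(Ω₀g) one has
⟨g, G′g⟩ = ⟨Ω₀g, S⁻¹Ω₀g⟩ = ⟨Su, u⟩ = ⟨u, Su⟩ ≥ 0.  No symmetry of A is needed.
[cite: Balaban1985BackgroundPropagators, p.394 (G′) + p.395 (positivity of G′)] -/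
theorem dirInv_qform_nonneg (A : Module.End ℝ (X → ℝ)) {χ : X → ℝ} (hχ : ∀ x, χ x = 0 ∨ χ x = 1)
    (hpos : ∀ f : X → ℝ, f ≠ 0 → 0 < ∑ x, f x * (A + mulOp (1 - χ) : Module.End ℝ (X → ℝ)) f x)
    (g : X → ℝ) : 0 ≤ ∑ x, g x * dirInv A χ g x := by
  have hS := posDef_sandwich hpos hχ (compl_add χ)
  have hSR := mul_inverse_of_posDef hS
  rw [← dirInv_add_compl A hχ, dirInv]
  set S : Module.End ℝ (X → ℝ) :=
    mulOp χ * (A + mulOp (1 - χ) : Module.End ℝ (X → ℝ)) * mulOp χ + mulOp (1 - χ) with hSdef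
  set u : X → ℝ := Ring.inverse S (mulOp χ g) with hudef
  have hSu : S u = mulOp χ g := by
    have := congrArg (fun T : Module.End ℝ (X → ℝ) => T (mulOp χ g)) hSR
    simpa only [Module.End.mul_apply, Module.End.one_apply] using this
  have hform : ∑ x, g x * (mulOp χ * Ring.inverse S * mulOp χ) g x = ∑ x, u x * S u x := by
    rw [hSu]
    refine Finset.sum_congr rfl fun x _ => ?_
    simp only [Module.End.mul_apply, mulOp_apply]
    rw [hudef]
    ring
  rw [hform]
  exact qform_nonneg_of_posDef hS u

end Generic

/-! ## §2  The Dirichlet package of the tower operator -/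

section Tower

variable {St Bd Cp : Type} [Fintype St] [DecidableEq St] [Fintype Bd] [Fintype Cp] [DecidableEq Cp]
  {src tgt : Bd → St} {Bs : ℕ → Type} [∀ j, Fintype (Bs j)] [∀ j, DecidableEq (Bs j)]
  (Ks : ∀ j, Comb src tgt (Bs j)) (Rm : Bd → Cp → Cp → ℝ)

omit [Fintype St] [DecidableEq St] [Fintype Bd] [∀ j, Fintype (Bs j)] [∀ j, DecidableEq (Bs j)] in
/-- **All tower transports reproduce covariantly constant fields** from the value at the level's representative
site: ∇_U f = 0 ⇒ Σ_m (towerTr_j x)_{im} f(x, m) = f(towerBlk_j x, i) (all bond weights c(b) ≠ 0; induction with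
`one_reproduces`, `Comb.tr_reproduces` and `gdev_tower_succ`). [cite: Balaban1985BackgroundPropagators, (3.18)–(3.19) p.393] -/
theorem towerTr_reproduces {c : Bd → ℝ} (hc : ∀ b, c b ≠ 0) {f : St × Cp → ℝ}
    (hDf : covD src tgt c Rm f = 0) :
    ∀ j x i, ∑ m, towerTr Ks Rm j x i m * f (x, m) = f (towerBlk Ks j x, i) := by
  intro j
  induction j with
  | zero => exact fun x i => one_reproduces f x i
  | succ j ih =>
      intro x i
      have h := gdev_tower_succ Ks Rm j f x i
      have h0 : ∀ m, gdev (towerBlk Ks j) (towerTr Ks Rm j) (fun y => y) f x m = 0 := fun m =>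
        sub_eq_zero.mpr (ih x m)
      have h1 : dev (Ks j) Rm f (towerBlk Ks j x) i = 0 :=
        sub_eq_zero.mpr ((Ks j).tr_reproduces Rm hc hDf (towerBlk Ks j x) i)
      simp only [h0, mul_zero, Finset.sum_const_zero, zero_add, h1] at h
      exact sub_eq_zero.mp h

/-- **Δ′ + (1 − Ω₀) IS STRICTLY POSITIVE UNDER THE COVER OF Ω₀ BY THE LEVELS** (Δ′ = the tower operator with block
weights; Ω₀ = {χ = 1}, χ {0,1}-valued; every site of Ω₀ has some level l ≤ k with a_l ≥ a_min > 0 and block weight of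
modulus ≥ w_min > 0) — from `coercive_towerOp` via `posDef_add_compl_of_coercive`; this is the invertibility of the
Dirichlet problem Ω₀Δ′Ω₀ on Ω₀. [cite: Balaban1985BackgroundPropagators, (3.16) p.393 + p.394 + p.395] -/
theorem posDef_towerDirOp (hRm : ∀ b i j, ∑ k, Rm b k i * Rm b k j = if i = j then (1 : ℝ) else 0)
    {c : Bd → ℝ} {cmin : ℝ} (hcmin : 0 < cmin) (hc : ∀ b, cmin ≤ |c b|) {D n : ℕ → ℕ}
    (hD : ∀ j x, (Ks j).depth x ≤ D j) (hn : ∀ j β, (univ.filter fun x => (Ks j).blk x = β).card ≤ n j)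
    (k : ℕ) (w : Fin (k + 1) → St → ℝ) {a : Fin (k + 1) → ℝ} (ha : ∀ l, 0 ≤ a l) {amin wmin : ℝ}
    (hamin : 0 < amin) (hwmin : 0 < wmin) {χ : St × Cp → ℝ} (hχ : ∀ p, χ p = 0 ∨ χ p = 1)
    (hcov : ∀ x i, χ (x, i) = 1 → ∃ l : Fin (k + 1), amin ≤ a l ∧ wmin ≤ |w l (towerBlk Ks (l : ℕ) x)|)
    (f : St × Cp → ℝ) (hf : f ≠ 0) :
    0 < ∑ p, f p * (towerOp Ks Rm c k (fun l x => w l (towerBlk Ks (l : ℕ) x)) a + mulOp (1 - χ) :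
      Module.End ℝ (St × Cp → ℝ)) f p :=
  posDef_add_compl_of_coercive _ hχ
    (qform_levelOp_nonneg src tgt c Rm (fun l : Fin (k + 1) => towerBlk Ks (l : ℕ))
      (fun l x => w l (towerBlk Ks (l : ℕ) x)) (fun l => towerTr Ks Rm (l : ℕ)) ha)
    (sigmaTower_pos cmin D n k hamin hwmin)
    (fun f hfχ => coercive_towerOp Ks Rm hRm hcmin hc hD hn k w ha hamin hwmin f
      fun x i hx => hcov x i (hfχ (x, i) hx)) f hf

/-- **G′ := `dirInv Δ′ Ω₀` IS A RIGHT INVERSE OF Ω₀Δ′Ω₀ ON Ω₀: Ω₀Δ′Ω₀·G′ = Ω₀** (Δ′ = the tower operator with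
block weights, Ω₀ covered by the levels as in `posDef_towerDirOp`; every transport).
[cite: Balaban1985BackgroundPropagators, (3.16) p.393 + (3.23)–(3.24) p.394 + p.394 (G′) + p.395] -/
theorem towerDir_right (hRm : ∀ b i j, ∑ k, Rm b k i * Rm b k j = if i = j then (1 : ℝ) else 0)
    {c : Bd → ℝ} {cmin : ℝ} (hcmin : 0 < cmin) (hc : ∀ b, cmin ≤ |c b|) {D n : ℕ → ℕ}
    (hD : ∀ j x, (Ks j).depth x ≤ D j) (hn : ∀ j β, (univ.filter fun x => (Ks j).blk x = β).card ≤ n j)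
    (k : ℕ) (w : Fin (k + 1) → St → ℝ) {a : Fin (k + 1) → ℝ} (ha : ∀ l, 0 ≤ a l) {amin wmin : ℝ}
    (hamin : 0 < amin) (hwmin : 0 < wmin) {χ : St × Cp → ℝ} (hχ : ∀ p, χ p = 0 ∨ χ p = 1)
    (hcov : ∀ x i, χ (x, i) = 1 → ∃ l : Fin (k + 1), amin ≤ a l ∧ wmin ≤ |w l (towerBlk Ks (l : ℕ) x)|) :
    mulOp χ * towerOp Ks Rm c k (fun l x => w l (towerBlk Ks (l : ℕ) x)) a * mulOp χ *
        dirInv (towerOp Ks Rm c k (fun l x => w l (towerBlk Ks (l : ℕ) x)) a) χ = mulOp χ := by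
  have h := sandwichΩ_mul_dirInv (posDef_towerDirOp Ks Rm hRm hcmin hc hD hn k w ha hamin hwmin hχ hcov) hχ
  rwa [sandwich_add_compl _ hχ, dirInv_add_compl _ hχ] at h

/-- **… AND A LEFT INVERSE: G′·Ω₀Δ′Ω₀ = Ω₀.** [cite: Balaban1985BackgroundPropagators, (3.16) p.393 + p.394 (G′) + p.395] -/
theorem towerDir_left (hRm : ∀ b i j, ∑ k, Rm b k i * Rm b k j = if i = j then (1 : ℝ) else 0)
    {c : Bd → ℝ} {cmin : ℝ} (hcmin : 0 < cmin) (hc : ∀ b, cmin ≤ |c b|) {D n : ℕ → ℕ}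
    (hD : ∀ j x, (Ks j).depth x ≤ D j) (hn : ∀ j β, (univ.filter fun x => (Ks j).blk x = β).card ≤ n j)
    (k : ℕ) (w : Fin (k + 1) → St → ℝ) {a : Fin (k + 1) → ℝ} (ha : ∀ l, 0 ≤ a l) {amin wmin : ℝ}
    (hamin : 0 < amin) (hwmin : 0 < wmin) {χ : St × Cp → ℝ} (hχ : ∀ p, χ p = 0 ∨ χ p = 1)
    (hcov : ∀ x i, χ (x, i) = 1 → ∃ l : Fin (k + 1), amin ≤ a l ∧ wmin ≤ |w l (towerBlk Ks (l : ℕ) x)|) :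
    dirInv (towerOp Ks Rm c k (fun l x => w l (towerBlk Ks (l : ℕ) x)) a) χ *
        (mulOp χ * towerOp Ks Rm c k (fun l x => w l (towerBlk Ks (l : ℕ) x)) a * mulOp χ) = mulOp χ := by
  have h := dirInv_mul_sandwichΩ (posDef_towerDirOp Ks Rm hRm hcmin hc hD hn k w ha hamin hwmin hχ hcov) hχ
  rwa [sandwich_add_compl _ hχ, dirInv_add_compl _ hχ] at h

omit [∀ j, Fintype (Bs j)] [∀ j, DecidableEq (Bs j)] in
/-- G′ lives on Ω₀: Ω₀G′Ω₀ = G′ (no hypothesis beyond χ {0,1}-valued). [folklore] -/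
theorem towerDir_supported (c : Bd → ℝ) (k : ℕ) (W : Fin (k + 1) → St → ℝ) (a : Fin (k + 1) → ℝ)
    {χ : St × Cp → ℝ} (hχ : ∀ p, χ p = 0 ∨ χ p = 1) :
    mulOp χ * dirInv (towerOp Ks Rm c k W a) χ * mulOp χ = dirInv (towerOp Ks Rm c k W a) χ :=
  mulOp_mul_dirInv_mul_mulOp _ hχ

/-- **G′ IS SYMMETRIC** (Δ′ is, `isTransposePair_levelOp`; then `isTransposePair_dirInv`).
[cite: Balaban1985BackgroundPropagators, p.391 + p.394 (G′)] -/
theorem isTransposePair_towerDir (hRm : ∀ b i j, ∑ k, Rm b k i * Rm b k j = if i = j then (1 : ℝ) else 0)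
    {c : Bd → ℝ} {cmin : ℝ} (hcmin : 0 < cmin) (hc : ∀ b, cmin ≤ |c b|) {D n : ℕ → ℕ}
    (hD : ∀ j x, (Ks j).depth x ≤ D j) (hn : ∀ j β, (univ.filter fun x => (Ks j).blk x = β).card ≤ n j)
    (k : ℕ) (w : Fin (k + 1) → St → ℝ) {a : Fin (k + 1) → ℝ} (ha : ∀ l, 0 ≤ a l) {amin wmin : ℝ}
    (hamin : 0 < amin) (hwmin : 0 < wmin) {χ : St × Cp → ℝ} (hχ : ∀ p, χ p = 0 ∨ χ p = 1)
    (hcov : ∀ x i, χ (x, i) = 1 → ∃ l : Fin (k + 1), amin ≤ a l ∧ wmin ≤ |w l (towerBlk Ks (l : ℕ) x)|) :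
    IsTransposePair (dirInv (towerOp Ks Rm c k (fun l x => w l (towerBlk Ks (l : ℕ) x)) a) χ)
      (dirInv (towerOp Ks Rm c k (fun l x => w l (towerBlk Ks (l : ℕ) x)) a) χ) := by
  rw [← dirInv_add_compl _ hχ]
  exact isTransposePair_dirInv
    ((isTransposePair_levelOp src tgt c Rm (fun l : Fin (k + 1) => towerBlk Ks (l : ℕ))
      (fun l x => w l (towerBlk Ks (l : ℕ) x)) (fun l => towerTr Ks Rm (l : ℕ)) a).add
      (isTransposePair_mulOp (1 - χ)))
    (posDef_towerDirOp Ks Rm hRm hcmin hc hD hn k w ha hamin hwmin hχ hcov) hχ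

/-- **⟨g, G′g⟩ ≥ 0** for the tower's Dirichlet inverse (`dirInv_qform_nonneg` + `posDef_towerDirOp`).
[cite: Balaban1985BackgroundPropagators, p.394 (G′) + p.395 (positivity of G′)] -/
theorem towerDir_qform_nonneg (hRm : ∀ b i j, ∑ k, Rm b k i * Rm b k j = if i = j then (1 : ℝ) else 0)
    {c : Bd → ℝ} {cmin : ℝ} (hcmin : 0 < cmin) (hc : ∀ b, cmin ≤ |c b|) {D n : ℕ → ℕ}
    (hD : ∀ j x, (Ks j).depth x ≤ D j) (hn : ∀ j β, (univ.filter fun x => (Ks j).blk x = β).card ≤ n j)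
    (k : ℕ) (w : Fin (k + 1) → St → ℝ) {a : Fin (k + 1) → ℝ} (ha : ∀ l, 0 ≤ a l) {amin wmin : ℝ}
    (hamin : 0 < amin) (hwmin : 0 < wmin) {χ : St × Cp → ℝ} (hχ : ∀ p, χ p = 0 ∨ χ p = 1)
    (hcov : ∀ x i, χ (x, i) = 1 → ∃ l : Fin (k + 1), amin ≤ a l ∧ wmin ≤ |w l (towerBlk Ks (l : ℕ) x)|)
    (g : St × Cp → ℝ) :
    0 ≤ ∑ p, g p * dirInv (towerOp Ks Rm c k (fun l x => w l (towerBlk Ks (l : ℕ) x)) a) χ g p :=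
  dirInv_qform_nonneg _ hχ (posDef_towerDirOp Ks Rm hRm hcmin hc hD hn k w ha hamin hwmin hχ hcov) g

/-- **Δ′ IS A UNIT UNDER THE FULL COVER** (every site has some level with a_l ≥ a_min, |w_l| ≥ w_min; every
transport) — `B9Thm37GlueTorusCovLevelsPoinc.isUnit_levelOp_of_dev` for the tower.
[cite: Balaban1985BackgroundPropagators, (3.16) p.393 + (3.23)–(3.24) p.394 + p.395] -/
theorem isUnit_towerOp (hRm : ∀ b i j, ∑ k, Rm b k i * Rm b k j = if i = j then (1 : ℝ) else 0)
    {c : Bd → ℝ} {cmin : ℝ} (hcmin : 0 < cmin) (hc : ∀ b, cmin ≤ |c b|) {D n : ℕ → ℕ}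
    (hD : ∀ j x, (Ks j).depth x ≤ D j) (hn : ∀ j β, (univ.filter fun x => (Ks j).blk x = β).card ≤ n j)
    (k : ℕ) (w : Fin (k + 1) → St → ℝ) {a : Fin (k + 1) → ℝ} (ha : ∀ l, 0 ≤ a l) {amin wmin : ℝ}
    (hamin : 0 < amin) (hwmin : 0 < wmin)
    (hcov : ∀ x, ∃ l : Fin (k + 1), amin ≤ a l ∧ wmin ≤ |w l (towerBlk Ks (l : ℕ) x)|) :
    IsUnit (towerOp Ks Rm c k (fun l x => w l (towerBlk Ks (l : ℕ) x)) a) :=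
  isUnit_levelOp_of_dev src tgt c Rm (fun l : Fin (k + 1) => towerBlk Ks (l : ℕ)) w
    (fun l => towerTr Ks Rm (l : ℕ)) (fun _ y => y) a univ (fun l _ => towerTr_orth Ks Rm hRm (l : ℕ)) ha
    (fun l _ => towerP_nonneg cmin D n (l : ℕ))
    (fun l _ f => tower_dev_sq_le Ks Rm hRm hcmin hc hD hn (l : ℕ) f) hamin hwmin
    fun x => by obtain ⟨l, hl⟩ := hcov x; exact ⟨l, mem_univ _, hl⟩

/-- Under the full cover, Δ′⁻¹·Δ′ = 1. [folklore] -/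
theorem inverse_mul_towerOp (hRm : ∀ b i j, ∑ k, Rm b k i * Rm b k j = if i = j then (1 : ℝ) else 0)
    {c : Bd → ℝ} {cmin : ℝ} (hcmin : 0 < cmin) (hc : ∀ b, cmin ≤ |c b|) {D n : ℕ → ℕ}
    (hD : ∀ j x, (Ks j).depth x ≤ D j) (hn : ∀ j β, (univ.filter fun x => (Ks j).blk x = β).card ≤ n j)
    (k : ℕ) (w : Fin (k + 1) → St → ℝ) {a : Fin (k + 1) → ℝ} (ha : ∀ l, 0 ≤ a l) {amin wmin : ℝ}
    (hamin : 0 < amin) (hwmin : 0 < wmin)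
    (hcov : ∀ x, ∃ l : Fin (k + 1), amin ≤ a l ∧ wmin ≤ |w l (towerBlk Ks (l : ℕ) x)|) :
    Ring.inverse (towerOp Ks Rm c k (fun l x => w l (towerBlk Ks (l : ℕ) x)) a) *
      towerOp Ks Rm c k (fun l x => w l (towerBlk Ks (l : ℕ) x)) a = 1 :=
  Ring.inverse_mul_cancel _ (isUnit_towerOp Ks Rm hRm hcmin hc hD hn k w ha hamin hwmin hcov)

/-- Under the full cover, Δ′·Δ′⁻¹ = 1. [folklore] -/
theorem mul_inverse_towerOp (hRm : ∀ b i j, ∑ k, Rm b k i * Rm b k j = if i = j then (1 : ℝ) else 0)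
    {c : Bd → ℝ} {cmin : ℝ} (hcmin : 0 < cmin) (hc : ∀ b, cmin ≤ |c b|) {D n : ℕ → ℕ}
    (hD : ∀ j x, (Ks j).depth x ≤ D j) (hn : ∀ j β, (univ.filter fun x => (Ks j).blk x = β).card ≤ n j)
    (k : ℕ) (w : Fin (k + 1) → St → ℝ) {a : Fin (k + 1) → ℝ} (ha : ∀ l, 0 ≤ a l) {amin wmin : ℝ}
    (hamin : 0 < amin) (hwmin : 0 < wmin)
    (hcov : ∀ x, ∃ l : Fin (k + 1), amin ≤ a l ∧ wmin ≤ |w l (towerBlk Ks (l : ℕ) x)|) :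
    towerOp Ks Rm c k (fun l x => w l (towerBlk Ks (l : ℕ) x)) a *
      Ring.inverse (towerOp Ks Rm c k (fun l x => w l (towerBlk Ks (l : ℕ) x)) a) = 1 :=
  Ring.mul_inverse_cancel _ (isUnit_towerOp Ks Rm hRm hcmin hc hD hn k w ha hamin hwmin hcov)

/-- **THE ℓ² DIRICHLET PACKAGE OF THE TOWER OPERATOR, UNIFORM IN THE TRANSPORT** (Δ′ = Δ_U + Σ_{l≤k} a_l G_lᵀG_l
with block weights; Ω₀ = {χ = 1} covered by the levels; G′ := `dirInv Δ′ χ`): (1) Ω₀Δ′Ω₀·G′ = Ω₀, (2) G′·Ω₀Δ′Ω₀ =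
Ω₀, (3) Ω₀G′Ω₀ = G′, (4) G′ symmetric, (5) ⟨g, G′g⟩ ≥ 0, (6) Σ_p (G′g)(p)² ≤ σ_k⁻²·Σ_p g(p)² with σ_k =
`sigmaTower a_min w_min c_min D n k` — the same six for every transport.  This is the ℓ² SHAPE of the G′ of
Theorem 3.7 for the printed operator; NO decay is asserted. [cite: Balaban1985BackgroundPropagators, (3.16) p.393 + (3.23)–(3.24) p.394 + p.394 (G′) + p.395 + Theorem 3.7 p.409 (shape only)] -/
theorem thm37_l2_tower (hRm : ∀ b i j, ∑ k, Rm b k i * Rm b k j = if i = j then (1 : ℝ) else 0)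
    {c : Bd → ℝ} {cmin : ℝ} (hcmin : 0 < cmin) (hc : ∀ b, cmin ≤ |c b|) {D n : ℕ → ℕ}
    (hD : ∀ j x, (Ks j).depth x ≤ D j) (hn : ∀ j β, (univ.filter fun x => (Ks j).blk x = β).card ≤ n j)
    (k : ℕ) (w : Fin (k + 1) → St → ℝ) {a : Fin (k + 1) → ℝ} (ha : ∀ l, 0 ≤ a l) {amin wmin : ℝ}
    (hamin : 0 < amin) (hwmin : 0 < wmin) {χ : St × Cp → ℝ} (hχ : ∀ p, χ p = 0 ∨ χ p = 1)
    (hcov : ∀ x i, χ (x, i) = 1 → ∃ l : Fin (k + 1), amin ≤ a l ∧ wmin ≤ |w l (towerBlk Ks (l : ℕ) x)|) :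
    (mulOp χ * towerOp Ks Rm c k (fun l x => w l (towerBlk Ks (l : ℕ) x)) a * mulOp χ *
        dirInv (towerOp Ks Rm c k (fun l x => w l (towerBlk Ks (l : ℕ) x)) a) χ = mulOp χ) ∧
    (dirInv (towerOp Ks Rm c k (fun l x => w l (towerBlk Ks (l : ℕ) x)) a) χ *
        (mulOp χ * towerOp Ks Rm c k (fun l x => w l (towerBlk Ks (l : ℕ) x)) a * mulOp χ) = mulOp χ) ∧
    (mulOp χ * dirInv (towerOp Ks Rm c k (fun l x => w l (towerBlk Ks (l : ℕ) x)) a) χ * mulOp χ =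
        dirInv (towerOp Ks Rm c k (fun l x => w l (towerBlk Ks (l : ℕ) x)) a) χ) ∧
    IsTransposePair (dirInv (towerOp Ks Rm c k (fun l x => w l (towerBlk Ks (l : ℕ) x)) a) χ)
      (dirInv (towerOp Ks Rm c k (fun l x => w l (towerBlk Ks (l : ℕ) x)) a) χ) ∧
    (∀ g : St × Cp → ℝ,
      0 ≤ ∑ p, g p * dirInv (towerOp Ks Rm c k (fun l x => w l (towerBlk Ks (l : ℕ) x)) a) χ g p) ∧
    (∀ g : St × Cp → ℝ,
      ∑ p, (dirInv (towerOp Ks Rm c k (fun l x => w l (towerBlk Ks (l : ℕ) x)) a) χ g) p ^ 2 ≤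
        (sigmaTower amin wmin cmin D n k ^ 2)⁻¹ * ∑ p, g p ^ 2) :=
  ⟨towerDir_right Ks Rm hRm hcmin hc hD hn k w ha hamin hwmin hχ hcov,
    towerDir_left Ks Rm hRm hcmin hc hD hn k w ha hamin hwmin hχ hcov,
    towerDir_supported Ks Rm c k (fun l x => w l (towerBlk Ks (l : ℕ) x)) a hχ,
    isTransposePair_towerDir Ks Rm hRm hcmin hc hD hn k w ha hamin hwmin hχ hcov,
    fun g => towerDir_qform_nonneg Ks Rm hRm hcmin hc hD hn k w ha hamin hwmin hχ hcov g,
    fun g => towerDir_sq_le Ks Rm hRm hcmin hc hD hn k w ha hamin hwmin hχ hcov g⟩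

end Tower

/-! ## §3  The torus: the ℓ² capstone for the cube-comb tower, uniform in the volume and the transport -/

section Torus

variable {d : ℕ} {N : Fin d → ℕ} [∀ i, NeZero (N i)] [NeZero d]

/-- **THE ℓ² DIRICHLET PACKAGE ON THE TORUS `UT N`, UNIFORM IN THE VOLUME AND THE TRANSPORT** — cube combs of
sides M_j (1 ≤ M_j, M_j ∣ N_i), Δ′ = the (k+1)-level tower operator with block weights, Ω₀ = {χ = 1} covered by the
levels, G′ := `dirInv Δ′ χ`: (1) Ω₀Δ′Ω₀·G′ = Ω₀, (2) G′·Ω₀Δ′Ω₀ = Ω₀, (3) Ω₀G′Ω₀ = G′, (4) G′ symmetric,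
(5) ⟨g, G′g⟩ ≥ 0, (6) Σ_p (G′g)(p)² ≤ σ_k⁻²·Σ_p g(p)² with σ_k = `sigmaTowerTorus d M a_min w_min c_min k`,
independent of N and of U.  ℓ² SHAPE only; NO decay. [cite: Balaban1985BackgroundPropagators, (3.16) p.393 + (3.23)–(3.24) p.394 + p.394 (G′) + p.395 + Theorem 3.7 p.409 (shape only)] -/
theorem thm37_l2_tower_torus {Cp : Type} [Fintype Cp] [DecidableEq Cp] {M : ℕ → ℕ} (hM : ∀ j, 1 ≤ M j)
    (hdiv : ∀ j i, M j ∣ N i) {Rm : UT N × Fin d → Cp → Cp → ℝ}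
    (hRm : ∀ b i j, ∑ k, Rm b k i * Rm b k j = if i = j then (1 : ℝ) else 0) {c : UT N × Fin d → ℝ}
    {cmin : ℝ} (hcmin : 0 < cmin) (hc : ∀ b, cmin ≤ |c b|) (k : ℕ) (w : Fin (k + 1) → UT N → ℝ)
    {a : Fin (k + 1) → ℝ} (ha : ∀ l, 0 ≤ a l) {amin wmin : ℝ} (hamin : 0 < amin) (hwmin : 0 < wmin)
    {χ : UT N × Cp → ℝ} (hχ : ∀ p, χ p = 0 ∨ χ p = 1)
    (hcov : ∀ x i, χ (x, i) = 1 → ∃ l : Fin (k + 1), amin ≤ a l ∧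
      wmin ≤ |w l (towerBlk (torusTower hM hdiv) (l : ℕ) x)|) :
    (mulOp χ * towerOp (torusTower hM hdiv) Rm c k
          (fun l x => w l (towerBlk (torusTower hM hdiv) (l : ℕ) x)) a * mulOp χ *
        dirInv (towerOp (torusTower hM hdiv) Rm c k
          (fun l x => w l (towerBlk (torusTower hM hdiv) (l : ℕ) x)) a) χ = mulOp χ) ∧
    (dirInv (towerOp (torusTower hM hdiv) Rm c k
          (fun l x => w l (towerBlk (torusTower hM hdiv) (l : ℕ) x)) a) χ *
        (mulOp χ * towerOp (torusTower hM hdiv) Rm c k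
          (fun l x => w l (towerBlk (torusTower hM hdiv) (l : ℕ) x)) a * mulOp χ) = mulOp χ) ∧
    (mulOp χ * dirInv (towerOp (torusTower hM hdiv) Rm c k
          (fun l x => w l (towerBlk (torusTower hM hdiv) (l : ℕ) x)) a) χ * mulOp χ =
        dirInv (towerOp (torusTower hM hdiv) Rm c k
          (fun l x => w l (towerBlk (torusTower hM hdiv) (l : ℕ) x)) a) χ) ∧
    IsTransposePair
      (dirInv (towerOp (torusTower hM hdiv) Rm c k
        (fun l x => w l (towerBlk (torusTower hM hdiv) (l : ℕ) x)) a) χ)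
      (dirInv (towerOp (torusTower hM hdiv) Rm c k
        (fun l x => w l (towerBlk (torusTower hM hdiv) (l : ℕ) x)) a) χ) ∧
    (∀ g : UT N × Cp → ℝ, 0 ≤ ∑ p, g p * dirInv (towerOp (torusTower hM hdiv) Rm c k
        (fun l x => w l (towerBlk (torusTower hM hdiv) (l : ℕ) x)) a) χ g p) ∧
    (∀ g : UT N × Cp → ℝ,
      ∑ p, (dirInv (towerOp (torusTower hM hdiv) Rm c k
          (fun l x => w l (towerBlk (torusTower hM hdiv) (l : ℕ) x)) a) χ g) p ^ 2 ≤
        (sigmaTowerTorus d M amin wmin cmin k ^ 2)⁻¹ * ∑ p, g p ^ 2) :=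
  thm37_l2_tower (torusTower hM hdiv) Rm hRm hcmin hc (fun j x => tdepth_le (hM j) x)
    (fun j z => card_block_le (hM j) (hdiv j) z) k w ha hamin hwmin hχ hcov

end Torus

end

end Literature.MathematicalPhysics.QuantumFieldTheory.Balaban1983to89.B9Thm37GlueTorusCovTowerDir
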